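import Literature.MathematicalPhysics.QuantumFieldTheory.Balaban1983to89.Node00.TorusCoverLandau153Tower
import Literature.MathematicalPhysics.QuantumFieldTheory.Balaban1983to89.B8Eq138LandauFlatOrthogonalRec

/-!
# NODE 00 — [Balaban1985RegularSpaces] Prop. 6's letters (1.136)₁₋₄ READ POINTWISE AT ANY LEVEL `m ≤ k` OF ANY TOWER `{Ω′_j}` (the p. 86 scaled sup norms `|·|_(−α)` unpacked
# for a general region sequence), and the `SU(N)` correction of the RECORD's Landau form (1.38)∕[Balaban1985Variational] (153) (`IsLandau138Z` ∘ `traceless`) — the family-generic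
# layer under this lineage's cube-specific g2∕g7 readings, as the R7 door of the «N05-REC» road needs it for the DENTED record tower `Node00.CubeB8DZ.sq`

Cell `pub-ymgap`, width seat `pub-ymgap-dag-n07-w3` g10 (N05-REC R7 pen).  NEW leaf, THEOREMS ONLY (no `def`, no `instance`, no `notation`).  CONSUMED BY NAME, nothing modified:
dag-n07-e's `Node00.TorusCoverPropSixGauge(10)` and this lineage's g0∕g7 `Node00.TorusCoverLandau153(Tower)` — whose readings `norm_mlogCfg_le_of_sides`, `bdd_gradFamily_of_sides`,
`norm_sub_le_of_msup_grad`, `bdd_codiffFamily_of_sides`, `norm_codiff_mlogCfg_le`, `bdd_lapFamily_of_sides`, `norm_lap_mlogCfg_le`, `isLandau138_traceless` are stated for a PURE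
engine cube datum `c : Node00.CubeB8` and read at its TOP level through «`□ ⊂ □_k`»; their proofs use of `c` only the family `c.sq` and the index `c.k`.  THIS FILE re-states them
for an ARBITRARY family `Ω : ℕ → Set ℤᵈ`, an arbitrary top index `k` and an arbitrary reading level `m ≤ k` (weights `(Lᵐη)^{−α}`), proofs verbatim; and proves the record-blocking
companion of `isLandau138_traceless` at the flat background (via dag-n05-d's `B8Eq138LandauFlatOrthogonalRec.QTZ_flat_apply`).  `--kind proof --supports stmt-QuantumFields-20541`
(K0⁷; count-neutral).  [6] = [Balaban1985RegularSpaces]; [15] = [Balaban1985Variational]; [I] = [Balaban1987RG1].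

WHY.  The R7 door consumes the record crown `Node00.GaugedBoundB8DZ` on the DENTED record tower `c.sq` of a `Node00.CubeB8DZ` ([15] (148)–(150): `Ω′_k = □_k ∩ Ω_k`): the top
box `□` lies in `Ω′_{k−1} = □_{k−1}` but NOT in `Ω′_k` (the dent), so (1.136)'s letters on `□` are read at level `k − 1` (weight `L·(Lᵏη)⁻¹`, dag-n07-e's «LOCATED-DENT-WEIGHTS
… harmless»), which the top-level-only engine readings cannot express; and the tower is a different family type, so the `CubeB8`-bound statements do not apply by name.

WHAT IS PROVED (sorry-free; `Ω : ℕ → Set ℤᵈ`, `k : ℕ`, `CStarAlgebra 𝔸`; hypotheses = the clauses of `GaugedBoundB8(D)(Z)` on `Ω`).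
* §1 `norm_mlogCfg_le_of_sides_fam` (`‖Ã‖ ≤ rη⁻¹` everywhere), `bdd_gradFamily_of_sides_fam`, `bdd_codiffFamily_of_sides_fam`, `bdd_lapFamily_of_sides_fam` (the p. 86 boundedness
  side conditions for the (1.136)₂₋₄ families of the masked exponent `Ã = mlogCfg k η Ω U₁`).
* §2 readings at level `m ≤ k`: ★ `norm_mlogCfg_le_at` (`‖Ã(x,ν)‖ ≤ r(Lᵐη)⁻¹` on a side touching `Ω_m`), ★ `norm_mlogCfg_sub_le_of_msup_grad_at` (`‖Ã(x+e_μ,ν) − Ã(x,ν)‖ ≤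
  ηr((Lᵐη)²)⁻¹`), ★ `norm_codiff_mlogCfg_le_at`, ★ `norm_lap_mlogCfg_le_at` (`≤ r((Lᵐη)³)⁻¹` on a bond touching `Ω_m`); unmasked forms on a window `W` every bond based at which is a side
  touching the tower (`mlogCfg_eq_logCfg_of_window`, `norm_logCfg_sub_le_of_msup_grad_at`, `norm_codiff_logCfg_le_at`, `norm_lap_logCfg_le_at`).
* §3 ★ `QTZ_traceless_flat`, ★★ `isLandau138Z_traceless_flat`: the RECORD multiplier form (1.38) at the flat background is stable under `A ↦ A − (Re tr A∕N)·1`.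
HONEST FRAMING: count-neutral kernel bookkeeping (the p. 86 supremum read pointwise; linearity of the record's `Q′ᵀ`); NO estimate of [6]∕[15]∕[I] asserted; `HThm4Rec`
UNDISCHARGED (caveat (C-S3-1)); N07 ∕ N05 NOT discharged; counts unmoved; one finite 𝕋⁴ programme at fixed ε — R4 closes the conditional finite-𝕋⁴ rung `BalabanLadder.UV` only;
the YM mass gap (Clay) is NOT proved by any of this; nothing continuum ∕ ℝ⁴ ∕ OS.

References: [6] Prop. 6 (1.135)–(1.138) p.99, p.86 (the scaled sup norm), (1.38) p.82, p.77 (bond convention); [15] (148)–(153) p.301; [I] (0.3)–(0.4) pp.252–253.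
-/

noncomputable section

namespace Literature.MathematicalPhysics.QuantumFieldTheory.Balaban1983to89.Node00

open scoped Matrix.Norms.L2Operator
open B7Prop1Explicit (e e_apply)
open B7Eq78Linearization (conjR conjR_apply)
open B8Ineq132 (covDerivFwd covDeriv BondTouches)
open B8Eq140Level (SideTouches sideTouches_of_bondTouches)
open B8Eq138LandauZd (logCfg covDivB covLap)
open B8Eq138LandauZdRec (QTZ IsLandau138Z)
open B8LeafModelZd3 (mlogCfg mlogCfg_of_sideTouches mlogCfg_of_not)
open B8ScaledSupNorm (msup Bdd bondNorm weight norm_le_of_msup_le)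
open B8Eq146AExpansion (plaqCovDeriv)
open B8Eq143PlaqExpansion (pdiv)

variable {d : ℕ}

/-! ## §1  The boundedness side conditions of the p. 86 supremum, for any family -/

section Family

variable {L : ℕ} (Ω : ℕ → Set (B7Prop1Explicit.Site d)) (k : ℕ)
variable {𝔸 : Type*} [CStarAlgebra 𝔸]

/-- **THE MASKED EXPONENT IS BOUNDED EVERYWHERE** once (1.136)₁ holds on every side touching some `Ω_j`, `j ≤ k`: `‖mlogCfg k η Ω U₁ y τ‖ ≤ r·η⁻¹` (`L ≥ 1`, `η > 0`, `r ≥ 0`; it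
vanishes off the sides) — dag-n07-e's `norm_mlogCfg_le_of_sides`, family-generic. [cite: Balaban1985RegularSpaces, (1.136) p.99, p.77 (bond convention)] -/
theorem norm_mlogCfg_le_of_sides_fam (hL : 1 ≤ L) {η r : ℝ} (hη : 0 < η) (hr : 0 ≤ r) (U₁ : B7Prop1Explicit.Site d → Fin d → 𝔸ˣ)
    (h136 : ∀ j, j ≤ k → ∀ b ∈ {b : B7Prop1Explicit.Site d × Fin d | SideTouches (Ω j) b.1 b.2}, ‖logCfg η U₁ b.1 b.2‖ ≤ r * ((L : ℝ) ^ j * η)⁻¹)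
    (y : B7Prop1Explicit.Site d) (τ : Fin d) : ‖mlogCfg k η Ω U₁ y τ‖ ≤ r * η⁻¹ := by
  classical
  by_cases h : ∃ j, j ≤ k ∧ SideTouches (Ω j) y τ
  · obtain ⟨j, hj, hs⟩ := h
    rw [mlogCfg_of_sideTouches η U₁ hj hs]
    refine (h136 j hj (y, τ) hs).trans (mul_le_mul_of_nonneg_left ?_ hr)
    rw [mul_inv]
    have hLj : (1 : ℝ) ≤ (L : ℝ) ^ j := one_le_pow₀ (by exact_mod_cast hL)
    calc ((L : ℝ) ^ j)⁻¹ * η⁻¹ ≤ 1 * η⁻¹ := mul_le_mul_of_nonneg_right (inv_le_one_of_one_le₀ hLj) (inv_nonneg.2 hη.le)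
      _ = η⁻¹ := one_mul _
  · push Not at h
    rw [mlogCfg_of_not η U₁ fun j hj => h j hj, norm_zero]
    positivity

/-- ★ **(1.136)₁ READ AT LEVEL `m`**: on a side touching `Ω_m`, `m ≤ k`, the masked exponent is the logarithm and `‖Ã(y, τ)‖ ≤ r·(Lᵐη)⁻¹`.
[cite: Balaban1985RegularSpaces, (1.136) p.99 («Lʲη|A| ≤ …»), p.77] -/
theorem norm_mlogCfg_le_at {η r : ℝ} (U₁ : B7Prop1Explicit.Site d → Fin d → 𝔸ˣ)
    (h136 : ∀ j, j ≤ k → ∀ b ∈ {b : B7Prop1Explicit.Site d × Fin d | SideTouches (Ω j) b.1 b.2}, ‖logCfg η U₁ b.1 b.2‖ ≤ r * ((L : ℝ) ^ j * η)⁻¹)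
    {m : ℕ} (hm : m ≤ k) {y : B7Prop1Explicit.Site d} {τ : Fin d} (hy : SideTouches (Ω m) y τ) :
    ‖mlogCfg k η Ω U₁ y τ‖ ≤ r * ((L : ℝ) ^ m * η)⁻¹ := by
  rw [mlogCfg_of_sideTouches η U₁ hm hy]
  exact h136 m hm (y, τ) hy

/-- **THE (1.136)₂ FAMILY IS BOUNDED** (`B8ScaledSupNorm.Bdd`), family-generic (dag-n07-e's `bdd_gradFamily_of_sides`). [cite: Balaban1985RegularSpaces, (1.136) p.99, p.86 (the scaled sup norm)] -/
theorem bdd_gradFamily_of_sides_fam (hL : 1 ≤ L) {η r : ℝ} (hη : 0 < η) (hr : 0 ≤ r) (U₁ : B7Prop1Explicit.Site d → Fin d → 𝔸ˣ)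
    (h136 : ∀ j, j ≤ k → ∀ b ∈ {b : B7Prop1Explicit.Site d × Fin d | SideTouches (Ω j) b.1 b.2}, ‖logCfg η U₁ b.1 b.2‖ ≤ r * ((L : ℝ) ^ j * η)⁻¹) :
    Bdd L k η (-(2 : ℝ)) (fun j (t : Fin d × Fin d × B7Prop1Explicit.Site d) => SideTouches (Ω j) t.2.2 t.2.1)
      (fun t => covDerivFwd η (1 : B7Prop1Explicit.Site d → Fin d → 𝔸ˣ) t.1 (fun z => mlogCfg k η Ω U₁ z t.2.1) t.2.2) := by
  refine ⟨((L : ℝ) ^ k * η) ^ (2 : ℝ) * (η⁻¹ * (2 * (r * η⁻¹))), fun j hj t _ => ?_⟩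
  have hscale : 0 < (L : ℝ) ^ j * η := B8ScaledSupNorm.scale_pos hL hη j
  have hw : weight L η (-(2 : ℝ)) j ≤ ((L : ℝ) ^ k * η) ^ (2 : ℝ) := by
    rw [weight, neg_neg]
    exact Real.rpow_le_rpow hscale.le (mul_le_mul_of_nonneg_right (pow_le_pow_right₀ (by exact_mod_cast hL) hj) hη.le) (by norm_num)
  have hF : ‖covDerivFwd η (1 : B7Prop1Explicit.Site d → Fin d → 𝔸ˣ) t.1 (fun z => mlogCfg k η Ω U₁ z t.2.1) t.2.2‖ ≤ η⁻¹ * (2 * (r * η⁻¹)) := by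
    rw [covDerivFwd, norm_smul, Real.norm_eq_abs, abs_of_pos (inv_pos.2 hη), conjR_apply, Pi.one_apply, Pi.one_apply, Units.val_one, one_mul,
      inv_one, Units.val_one, mul_one]
    refine mul_le_mul_of_nonneg_left ((norm_sub_le _ _).trans ?_) (inv_nonneg.2 hη.le)
    have h1 := norm_mlogCfg_le_of_sides_fam Ω k hL hη hr U₁ h136 (t.2.2 + e t.1) t.2.1
    have h2 := norm_mlogCfg_le_of_sides_fam Ω k hL hη hr U₁ h136 t.2.2 t.2.1
    linarith
  exact mul_le_mul hw hF (norm_nonneg _) (by positivity)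

/-- **THE (1.136)₃ FAMILY IS BOUNDED** (`B8ScaledSupNorm.Bdd`), family-generic (dag-n07-e's `bdd_codiffFamily_of_sides`). [cite: Balaban1985RegularSpaces, Prop. 6 (1.136) p.99, p.86 (the scaled sup norm)] -/
theorem bdd_codiffFamily_of_sides_fam (hL : 1 ≤ L) {η r : ℝ} (hη : 0 < η) (hr : 0 ≤ r) (U₁ : B7Prop1Explicit.Site d → Fin d → 𝔸ˣ)
    (h136 : ∀ j, j ≤ k → ∀ b ∈ {b : B7Prop1Explicit.Site d × Fin d | SideTouches (Ω j) b.1 b.2}, ‖logCfg η U₁ b.1 b.2‖ ≤ r * ((L : ℝ) ^ j * η)⁻¹) :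
    Bdd L k η (-(3 : ℝ)) (fun j (b : B7Prop1Explicit.Site d × Fin d) => BondTouches (Ω j) b.1 b.2)
      (fun b => pdiv η (1 : B7Prop1Explicit.Site d → Fin d → 𝔸ˣ) (plaqCovDeriv η 1 (mlogCfg k η Ω U₁)) b.2 b.1) := by
  refine ⟨((L : ℝ) ^ k * η) ^ (3 : ℝ) * (2 * d * (η⁻¹ * (2 * (η⁻¹ * (4 * (r * η⁻¹)))))), fun j hj b _ => ?_⟩
  have hscale : 0 < (L : ℝ) ^ j * η := B8ScaledSupNorm.scale_pos hL hη j
  have hw : weight L η (-(3 : ℝ)) j ≤ ((L : ℝ) ^ k * η) ^ (3 : ℝ) := by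
    rw [weight, neg_neg]
    exact Real.rpow_le_rpow hscale.le (mul_le_mul_of_nonneg_right (pow_le_pow_right₀ (by exact_mod_cast hL) hj) hη.le) (by norm_num)
  have hm : ∀ y κ, ‖mlogCfg k η Ω U₁ y κ‖ ≤ r * η⁻¹ := norm_mlogCfg_le_of_sides_fam Ω k hL hη hr U₁ h136
  have hF := norm_pdiv_one_le hη (fun a b y => norm_plaqCovDeriv_one_le hη hm a b y) b.2 b.1
  exact mul_le_mul hw hF (norm_nonneg _) (by positivity)

/-- **THE (1.136)₄ FAMILY IS BOUNDED** (`B8ScaledSupNorm.Bdd`), family-generic (this lineage's g2 `bdd_lapFamily_of_sides`). [cite: Balaban1985RegularSpaces, Prop. 6 (1.136) p.99, p.86 (the scaled sup norm)] -/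
theorem bdd_lapFamily_of_sides_fam (hL : 1 ≤ L) {η r : ℝ} (hη : 0 < η) (hr : 0 ≤ r) (U₁ : B7Prop1Explicit.Site d → Fin d → 𝔸ˣ)
    (h136 : ∀ j, j ≤ k → ∀ b ∈ {b : B7Prop1Explicit.Site d × Fin d | SideTouches (Ω j) b.1 b.2}, ‖logCfg η U₁ b.1 b.2‖ ≤ r * ((L : ℝ) ^ j * η)⁻¹) :
    Bdd L k η (-(3 : ℝ)) (fun j (b : B7Prop1Explicit.Site d × Fin d) => BondTouches (Ω j) b.1 b.2)
      (fun b => covLap η (1 : B7Prop1Explicit.Site d → Fin d → 𝔸ˣ) (fun z => mlogCfg k η Ω U₁ z b.2) b.1) := by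
  refine ⟨((L : ℝ) ^ k * η) ^ (3 : ℝ) * (d * (η⁻¹ * (η⁻¹ * (4 * (r * η⁻¹))))), fun j hj b _ => ?_⟩
  have hscale : 0 < (L : ℝ) ^ j * η := B8ScaledSupNorm.scale_pos hL hη j
  have hw : B8ScaledSupNorm.weight L η (-(3 : ℝ)) j ≤ ((L : ℝ) ^ k * η) ^ (3 : ℝ) := by
    rw [B8ScaledSupNorm.weight, neg_neg]
    exact Real.rpow_le_rpow hscale.le (mul_le_mul_of_nonneg_right (pow_le_pow_right₀ (by exact_mod_cast hL) hj) hη.le) (by norm_num)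
  have hm : ∀ y, ‖mlogCfg k η Ω U₁ y b.2‖ ≤ r * η⁻¹ := fun y => norm_mlogCfg_le_of_sides_fam Ω k hL hη hr U₁ h136 y b.2
  have hF := norm_covLap_one_le hη hm b.1
  exact mul_le_mul hw hF (norm_nonneg _) (by positivity)

/-! ## §2  The (1.136)₂₋₄ members read pointwise at a level `m ≤ k` -/

/-- ★ **`|∇Ã|_(−2) ≤ r` READ POINTWISE AT LEVEL `m`**: for a derivative quadruple `(μ, ν, x)` whose base bond `⟨x, x+e_ν⟩` is a side touching `Ω_m`, `m ≤ k`,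
`‖Ã(x+e_μ, ν) − Ã(x, ν)‖ ≤ η·r·((Lᵐη)²)⁻¹` (masked exponent `Ã = mlogCfg k η Ω U₁`). [cite: Balaban1985RegularSpaces, (1.136) p.99 («(Lʲη)²|∇^η A| ≤ …»), p.86] -/
theorem norm_mlogCfg_sub_le_of_msup_grad_at (hL : 1 ≤ L) {η r : ℝ} (hη : 0 < η) (hr : 0 ≤ r) (U₁ : B7Prop1Explicit.Site d → Fin d → 𝔸ˣ)
    (h136 : ∀ j, j ≤ k → ∀ b ∈ {b : B7Prop1Explicit.Site d × Fin d | SideTouches (Ω j) b.1 b.2}, ‖logCfg η U₁ b.1 b.2‖ ≤ r * ((L : ℝ) ^ j * η)⁻¹)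
    (hgrad : msup L k η (-(2 : ℝ)) (fun j (t : Fin d × Fin d × B7Prop1Explicit.Site d) => SideTouches (Ω j) t.2.2 t.2.1)
      (fun t => covDerivFwd η (1 : B7Prop1Explicit.Site d → Fin d → 𝔸ˣ) t.1 (fun z => mlogCfg k η Ω U₁ z t.2.1) t.2.2) ≤ r)
    {m : ℕ} (hm : m ≤ k) {x : B7Prop1Explicit.Site d} {μ ν : Fin d} (hmem : SideTouches (Ω m) x ν) :
    ‖mlogCfg k η Ω U₁ (x + e μ) ν - mlogCfg k η Ω U₁ x ν‖ ≤ η * r * (((L : ℝ) ^ m * η) ^ 2)⁻¹ := by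
  have h := norm_le_of_msup_le (F := fun t : Fin d × Fin d × B7Prop1Explicit.Site d =>
      covDerivFwd η (1 : B7Prop1Explicit.Site d → Fin d → 𝔸ˣ) t.1 (fun z => mlogCfg k η Ω U₁ z t.2.1) t.2.2)
    (mem := fun j (t : Fin d × Fin d × B7Prop1Explicit.Site d) => SideTouches (Ω j) t.2.2 t.2.1)
    hL hη (bdd_gradFamily_of_sides_fam Ω k hL hη hr U₁ h136) hgrad hm (i := (μ, ν, x)) hmem
  simp only [covDerivFwd, conjR_apply, Pi.one_apply, Units.val_one, one_mul, inv_one, mul_one] at h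
  rw [norm_smul, Real.norm_eq_abs, abs_of_pos (inv_pos.2 hη)] at h
  have hscale : 0 < (L : ℝ) ^ m * η := B8ScaledSupNorm.scale_pos hL hη m
  have hrpow : ((L : ℝ) ^ m * η) ^ (-(2 : ℝ)) = (((L : ℝ) ^ m * η) ^ 2)⁻¹ := by
    rw [Real.rpow_neg hscale.le, Real.rpow_two]
  rw [hrpow] at h
  -- `h : η⁻¹ * ‖Ã(x+e_μ,ν) − Ã(x,ν)‖ ≤ r·((Lᵐη)²)⁻¹`
  have hη' : 0 < η⁻¹ := inv_pos.2 hη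
  calc ‖mlogCfg k η Ω U₁ (x + e μ) ν - mlogCfg k η Ω U₁ x ν‖
      = η * (η⁻¹ * ‖mlogCfg k η Ω U₁ (x + e μ) ν - mlogCfg k η Ω U₁ x ν‖) := by field_simp
    _ ≤ η * (r * (((L : ℝ) ^ m * η) ^ 2)⁻¹) := mul_le_mul_of_nonneg_left h hη.le
    _ = η * r * (((L : ℝ) ^ m * η) ^ 2)⁻¹ := by ring

/-- ★ **`|∂^{η*}∂^ηÃ|_(−3) ≤ r` READ POINTWISE AT LEVEL `m`**: on a bond `⟨x, x+e_μ⟩` touching `Ω_m`, `m ≤ k`, `‖(∂^{η*}∂^ηÃ)(x, x+e_μ)‖ ≤ r·((Lᵐη)³)⁻¹`.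
[cite: Balaban1985RegularSpaces, Prop. 6 (1.136) p.99 («(Lʲη)³|∂^{η*}∂^η A| ≤ …»), p.86] -/
theorem norm_codiff_mlogCfg_le_at (hL : 1 ≤ L) {η r : ℝ} (hη : 0 < η) (hr : 0 ≤ r) (U₁ : B7Prop1Explicit.Site d → Fin d → 𝔸ˣ)
    (h136 : ∀ j, j ≤ k → ∀ b ∈ {b : B7Prop1Explicit.Site d × Fin d | SideTouches (Ω j) b.1 b.2}, ‖logCfg η U₁ b.1 b.2‖ ≤ r * ((L : ℝ) ^ j * η)⁻¹)
    (hcod : bondNorm L k η (-(3 : ℝ)) Ω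
        (fun x μ => pdiv η (1 : B7Prop1Explicit.Site d → Fin d → 𝔸ˣ) (plaqCovDeriv η 1 (mlogCfg k η Ω U₁)) μ x) ≤ r)
    {m : ℕ} (hm : m ≤ k) {x : B7Prop1Explicit.Site d} {μ : Fin d} (hmem : BondTouches (Ω m) x μ) :
    ‖pdiv η (1 : B7Prop1Explicit.Site d → Fin d → 𝔸ˣ) (plaqCovDeriv η 1 (mlogCfg k η Ω U₁)) μ x‖ ≤ r * (((L : ℝ) ^ m * η) ^ 3)⁻¹ := by
  have h := norm_le_of_msup_le (F := fun b : B7Prop1Explicit.Site d × Fin d =>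
      pdiv η (1 : B7Prop1Explicit.Site d → Fin d → 𝔸ˣ) (plaqCovDeriv η 1 (mlogCfg k η Ω U₁)) b.2 b.1)
    (mem := fun j (b : B7Prop1Explicit.Site d × Fin d) => BondTouches (Ω j) b.1 b.2)
    hL hη (bdd_codiffFamily_of_sides_fam Ω k hL hη hr U₁ h136) hcod hm (i := (x, μ)) hmem
  have hscale : 0 < (L : ℝ) ^ m * η := B8ScaledSupNorm.scale_pos hL hη m
  have hrpow : ((L : ℝ) ^ m * η) ^ (-(3 : ℝ)) = (((L : ℝ) ^ m * η) ^ 3)⁻¹ := by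
    rw [Real.rpow_neg hscale.le, show (3 : ℝ) = ((3 : ℕ) : ℝ) by norm_num, Real.rpow_natCast]
  rw [hrpow] at h
  exact h

/-- ★ **`|Δ^ηÃ|_(−3) ≤ r` READ POINTWISE AT LEVEL `m`**: on a bond `⟨x, x+e_μ⟩` touching `Ω_m`, `m ≤ k`, `‖(Δ^ηÃ_μ)(x)‖ ≤ r·((Lᵐη)³)⁻¹`.
[cite: Balaban1985RegularSpaces, Prop. 6 (1.136) p.99 («(Lʲη)³|Δ^η A| ≤ …»), p.86] -/
theorem norm_lap_mlogCfg_le_at (hL : 1 ≤ L) {η r : ℝ} (hη : 0 < η) (hr : 0 ≤ r) (U₁ : B7Prop1Explicit.Site d → Fin d → 𝔸ˣ)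
    (h136 : ∀ j, j ≤ k → ∀ b ∈ {b : B7Prop1Explicit.Site d × Fin d | SideTouches (Ω j) b.1 b.2}, ‖logCfg η U₁ b.1 b.2‖ ≤ r * ((L : ℝ) ^ j * η)⁻¹)
    (hlap : bondNorm L k η (-(3 : ℝ)) Ω
        (fun x μ => covLap η (1 : B7Prop1Explicit.Site d → Fin d → 𝔸ˣ) (fun z => mlogCfg k η Ω U₁ z μ) x) ≤ r)
    {m : ℕ} (hm : m ≤ k) {x : B7Prop1Explicit.Site d} {μ : Fin d} (hmem : BondTouches (Ω m) x μ) :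
    ‖covLap η (1 : B7Prop1Explicit.Site d → Fin d → 𝔸ˣ) (fun z => mlogCfg k η Ω U₁ z μ) x‖ ≤ r * (((L : ℝ) ^ m * η) ^ 3)⁻¹ := by
  have h := B8ScaledSupNorm.norm_le_of_msup_le (F := fun b : B7Prop1Explicit.Site d × Fin d =>
      covLap η (1 : B7Prop1Explicit.Site d → Fin d → 𝔸ˣ) (fun z => mlogCfg k η Ω U₁ z b.2) b.1)
    (mem := fun j (b : B7Prop1Explicit.Site d × Fin d) => BondTouches (Ω j) b.1 b.2)
    hL hη (bdd_lapFamily_of_sides_fam Ω k hL hη hr U₁ h136) hlap hm (i := (x, μ)) hmem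
  have hscale : 0 < (L : ℝ) ^ m * η := B8ScaledSupNorm.scale_pos hL hη m
  have hrpow : ((L : ℝ) ^ m * η) ^ (-(3 : ℝ)) = (((L : ℝ) ^ m * η) ^ 3)⁻¹ := by
    rw [Real.rpow_neg hscale.le, show (3 : ℝ) = ((3 : ℕ) : ℝ) by norm_num, Real.rpow_natCast]
  rw [hrpow] at h
  exact h

/-! ### Unmasked forms on a window every bond based at which is a side touching the tower -/

/-- On a window `W` every bond based at which is a side touching some `Ω_j`, `j ≤ k`, the masked exponent IS the logarithm. [cite: Balaban1985RegularSpaces, (1.135)–(1.136) p.99, p.77] -/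
theorem mlogCfg_eq_logCfg_of_window (η : ℝ) (U₁ : B7Prop1Explicit.Site d → Fin d → 𝔸ˣ) {W : Set (B7Prop1Explicit.Site d)}
    (hW : ∀ y ∈ W, ∀ τ : Fin d, ∃ j, j ≤ k ∧ SideTouches (Ω j) y τ) {y : B7Prop1Explicit.Site d} (hy : y ∈ W) (τ : Fin d) :
    mlogCfg k η Ω U₁ y τ = logCfg η U₁ y τ := by
  obtain ⟨j, hj, hs⟩ := hW y hy τ
  exact mlogCfg_of_sideTouches η U₁ hj hs

/-- `|∇A|_(−2) ≤ r` READ POINTWISE AT LEVEL `m`, UNMASKED: `x, x + e_μ ∈ W` (both bonds masked-in) and `⟨x, x+e_ν⟩` a side touching `Ω_m` give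
`‖A(x+e_μ, ν) − A(x, ν)‖ ≤ η·r·((Lᵐη)²)⁻¹`, `A = logCfg η U₁`. [cite: Balaban1985RegularSpaces, (1.136) p.99, p.86] -/
theorem norm_logCfg_sub_le_of_msup_grad_at (hL : 1 ≤ L) {η r : ℝ} (hη : 0 < η) (hr : 0 ≤ r) (U₁ : B7Prop1Explicit.Site d → Fin d → 𝔸ˣ)
    (h136 : ∀ j, j ≤ k → ∀ b ∈ {b : B7Prop1Explicit.Site d × Fin d | SideTouches (Ω j) b.1 b.2}, ‖logCfg η U₁ b.1 b.2‖ ≤ r * ((L : ℝ) ^ j * η)⁻¹)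
    (hgrad : msup L k η (-(2 : ℝ)) (fun j (t : Fin d × Fin d × B7Prop1Explicit.Site d) => SideTouches (Ω j) t.2.2 t.2.1)
      (fun t => covDerivFwd η (1 : B7Prop1Explicit.Site d → Fin d → 𝔸ˣ) t.1 (fun z => mlogCfg k η Ω U₁ z t.2.1) t.2.2) ≤ r)
    {W : Set (B7Prop1Explicit.Site d)} (hW : ∀ y ∈ W, ∀ τ : Fin d, ∃ j, j ≤ k ∧ SideTouches (Ω j) y τ)
    {m : ℕ} (hm : m ≤ k) {x : B7Prop1Explicit.Site d} {μ ν : Fin d} (hx : x ∈ W) (hxμ : x + e μ ∈ W) (hmem : SideTouches (Ω m) x ν) :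
    ‖logCfg η U₁ (x + e μ) ν - logCfg η U₁ x ν‖ ≤ η * r * (((L : ℝ) ^ m * η) ^ 2)⁻¹ := by
  have h := norm_mlogCfg_sub_le_of_msup_grad_at Ω k hL hη hr U₁ h136 hgrad hm (μ := μ) hmem
  rwa [mlogCfg_eq_logCfg_of_window Ω k η U₁ hW hx, mlogCfg_eq_logCfg_of_window Ω k η U₁ hW hxμ] at h

/-- `|∂^{η*}∂^ηA|_(−3) ≤ r` READ POINTWISE AT LEVEL `m`, UNMASKED: if the base points `x`, `x + e_μ`, `x ± e_ν`, `x − e_ν + e_μ` of the stencil lie in `W` and `⟨x, x+e_μ⟩` touches `Ω_m`,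
`‖(∂^{η*}∂^ηA)(x, x+e_μ)‖ ≤ r·((Lᵐη)³)⁻¹`, `A = logCfg η U₁`. [cite: Balaban1985RegularSpaces, Prop. 6 (1.135)–(1.136) p.99] -/
theorem norm_codiff_logCfg_le_at (hL : 1 ≤ L) {η r : ℝ} (hη : 0 < η) (hr : 0 ≤ r) (U₁ : B7Prop1Explicit.Site d → Fin d → 𝔸ˣ)
    (h136 : ∀ j, j ≤ k → ∀ b ∈ {b : B7Prop1Explicit.Site d × Fin d | SideTouches (Ω j) b.1 b.2}, ‖logCfg η U₁ b.1 b.2‖ ≤ r * ((L : ℝ) ^ j * η)⁻¹)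
    (hcod : bondNorm L k η (-(3 : ℝ)) Ω
        (fun x μ => pdiv η (1 : B7Prop1Explicit.Site d → Fin d → 𝔸ˣ) (plaqCovDeriv η 1 (mlogCfg k η Ω U₁)) μ x) ≤ r)
    {W : Set (B7Prop1Explicit.Site d)} (hW : ∀ y ∈ W, ∀ τ : Fin d, ∃ j, j ≤ k ∧ SideTouches (Ω j) y τ)
    {m : ℕ} (hm : m ≤ k) {x : B7Prop1Explicit.Site d} {μ : Fin d} (hx : x ∈ W) (hxμ : x + e μ ∈ W)
    (hν : ∀ ν, x + e ν ∈ W ∧ x - e ν ∈ W ∧ x - e ν + e μ ∈ W) (hmem : BondTouches (Ω m) x μ) :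
    ‖pdiv η (1 : B7Prop1Explicit.Site d → Fin d → 𝔸ˣ) (plaqCovDeriv η 1 (logCfg η U₁)) μ x‖ ≤ r * (((L : ℝ) ^ m * η) ^ 3)⁻¹ := by
  have heq := pdiv_plaqCovDeriv_one_congr η (A := mlogCfg k η Ω U₁) (A' := logCfg η U₁) (x := x) (μ := μ)
    (fun κ => mlogCfg_eq_logCfg_of_window Ω k η U₁ hW hx κ) (fun κ => mlogCfg_eq_logCfg_of_window Ω k η U₁ hW hxμ κ)
    (fun ν κ => ⟨mlogCfg_eq_logCfg_of_window Ω k η U₁ hW (hν ν).1 κ, mlogCfg_eq_logCfg_of_window Ω k η U₁ hW (hν ν).2.1 κ,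
      mlogCfg_eq_logCfg_of_window Ω k η U₁ hW (hν ν).2.2 κ⟩)
  rw [← heq]
  exact norm_codiff_mlogCfg_le_at Ω k hL hη hr U₁ h136 hcod hm hmem

/-- `|Δ^ηA|_(−3) ≤ r` READ POINTWISE AT LEVEL `m`, UNMASKED: if `x`, `x ± e_ν` lie in `W` and `⟨x, x+e_μ⟩` touches `Ω_m`, `‖(Δ^ηA_μ)(x)‖ ≤ r·((Lᵐη)³)⁻¹`, `A = logCfg η U₁`.
[cite: Balaban1985RegularSpaces, Prop. 6 (1.135)–(1.136) p.99] -/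
theorem norm_lap_logCfg_le_at (hL : 1 ≤ L) {η r : ℝ} (hη : 0 < η) (hr : 0 ≤ r) (U₁ : B7Prop1Explicit.Site d → Fin d → 𝔸ˣ)
    (h136 : ∀ j, j ≤ k → ∀ b ∈ {b : B7Prop1Explicit.Site d × Fin d | SideTouches (Ω j) b.1 b.2}, ‖logCfg η U₁ b.1 b.2‖ ≤ r * ((L : ℝ) ^ j * η)⁻¹)
    (hlap : bondNorm L k η (-(3 : ℝ)) Ω
        (fun x μ => covLap η (1 : B7Prop1Explicit.Site d → Fin d → 𝔸ˣ) (fun z => mlogCfg k η Ω U₁ z μ) x) ≤ r)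
    {W : Set (B7Prop1Explicit.Site d)} (hW : ∀ y ∈ W, ∀ τ : Fin d, ∃ j, j ≤ k ∧ SideTouches (Ω j) y τ)
    {m : ℕ} (hm : m ≤ k) {x : B7Prop1Explicit.Site d} (hx : x ∈ W) (hν : ∀ ν, x + e ν ∈ W ∧ x - e ν ∈ W) {μ : Fin d}
    (hmem : BondTouches (Ω m) x μ) :
    ‖covLap η (1 : B7Prop1Explicit.Site d → Fin d → 𝔸ˣ) (fun z => logCfg η U₁ z μ) x‖ ≤ r * (((L : ℝ) ^ m * η) ^ 3)⁻¹ := by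
  have heq := covLap_one_congr η (F := fun z => mlogCfg k η Ω U₁ z μ) (F' := fun z => logCfg η U₁ z μ) (x := x)
    (mlogCfg_eq_logCfg_of_window Ω k η U₁ hW hx μ)
    (fun ν => ⟨mlogCfg_eq_logCfg_of_window Ω k η U₁ hW (hν ν).1 μ, mlogCfg_eq_logCfg_of_window Ω k η U₁ hW (hν ν).2 μ⟩)
  rw [← heq]
  exact norm_lap_mlogCfg_le_at Ω k hL hη hr U₁ h136 hlap hm hmem

end Family

/-! ## §3  The record's (1.38) ∕ (153) in multiplier form at the flat background is stable under the `SU(N)` correction -/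

section Traceless

variable {N : ℕ} [NeZero N]

omit [NeZero N] in
/-- ★ **The record's `Q′ᵀ` (centred blocks) commutes with the traceless correction at the flat background** (odd `L`): `QTZ L m Λs 1 (traceless ∘ μ) x = traceless (QTZ L m Λs 1 μ x)` —
by dag-n05-d's closed form `QTZ_flat_apply` (a real-weighted finite sum of indicators). [cite: Balaban1985BackgroundPropagators, (3.24) p.394 (bookkeeping); Balaban1987RG1, (0.3) p.252] -/
theorem QTZ_traceless_flat {L : ℕ} (hL : Odd L) (m : ℕ) (Λs : ℕ → Set (B7Prop1Explicit.Site d)) (μ : ℕ → B7Prop1Explicit.Site d → MatA N)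
    (x : B7Prop1Explicit.Site d) :
    QTZ L m Λs (1 : B7Prop1Explicit.Site d → Fin d → (MatA N)ˣ) (fun j z => traceless (μ j z)) x =
      traceless (QTZ L m Λs (1 : B7Prop1Explicit.Site d → Fin d → (MatA N)ˣ) μ x) := by
  set T : MatA N →+ MatA N := AddMonoidHom.mk' (traceless (N := N)) traceless_add with hT
  rw [B8Eq138LandauFlatOrthogonalRec.QTZ_flat_apply hL, B8Eq138LandauFlatOrthogonalRec.QTZ_flat_apply hL]
  show _ = T _
  rw [map_sum]
  refine Finset.sum_congr rfl fun j _ => ?_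
  show _ = traceless _
  rw [traceless_smul_real, indicator_traceless]

omit [NeZero N] in
/-- ★★ **THE RECORD's (1.38) ∕ (153) IN MULTIPLIER FORM IS STABLE UNDER THE `SU(N)` CORRECTION at the flat background** (odd `L`): if `Δ^η↾Ω₀(D^{η*}A) = Q′ᵀμ` on `Ω₀` for the
CENTRED blocking (dag-n05-d's `IsLandau138Z … 1 A`), then the traceless part `A − (Re tr A∕N)·1` satisfies it with the multiplier `traceless ∘ μ` — the record companion of this
lineage's g0 `isLandau138_traceless`; it lets the `U(N) → SU(N)` normalisation of [6] Thm 2's gauge keep print's gauge condition on the record tower.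
[cite: Balaban1985RegularSpaces, (1.38) p.82; Balaban1985Variational, (153) p.301; Balaban1987RG1, (0.3)–(0.4) pp.252–253] -/
theorem isLandau138Z_traceless_flat {L m : ℕ} (hL : Odd L) {η : ℝ} {Ω₀ : Set (B7Prop1Explicit.Site d)} {Λs : ℕ → Set (B7Prop1Explicit.Site d)}
    {A : B7Prop1Explicit.Site d → Fin d → MatA N} (h : IsLandau138Z L m η Ω₀ Λs (1 : B7Prop1Explicit.Site d → Fin d → (MatA N)ˣ) A) :
    IsLandau138Z L m η Ω₀ Λs (1 : B7Prop1Explicit.Site d → Fin d → (MatA N)ˣ) (fun z μ => traceless (A z μ)) := by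
  obtain ⟨μ, hμ⟩ := h
  refine ⟨fun j z => traceless (μ j z), fun x hx => ?_⟩
  have hdiv : covDivB η (1 : B7Prop1Explicit.Site d → Fin d → (MatA N)ˣ) (fun z κ => traceless (A z κ)) =
      fun z => traceless (covDivB η (1 : B7Prop1Explicit.Site d → Fin d → (MatA N)ˣ) A z) :=
    funext (covDivB_traceless η _ A)
  rw [hdiv, indicator_traceless, covLap_traceless, QTZ_traceless_flat hL, hμ x hx]

end Traceless

end Literature.MathematicalPhysics.QuantumFieldTheory.Balaban1983to89.Node00

end

/-! ## Axiom audit (gate whitelist: `propext`, `Classical.choice`, `Quot.sound`) -/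
#print axioms Literature.MathematicalPhysics.QuantumFieldTheory.Balaban1983to89.Node00.norm_logCfg_sub_le_of_msup_grad_at
#print axioms Literature.MathematicalPhysics.QuantumFieldTheory.Balaban1983to89.Node00.norm_codiff_logCfg_le_at
#print axioms Literature.MathematicalPhysics.QuantumFieldTheory.Balaban1983to89.Node00.isLandau138Z_traceless_flat
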